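import Mathlib.MeasureTheory.Constructions.HaarToSphere
import Mathlib.MeasureTheory.Measure.Lebesgue.VolumeOfBalls
import Mathlib.MeasureTheory.Integral.IntegralEqImproper
import Mathlib.Topology.Instances.Matrix
import Literature.Geometry.Lorentzian.EndFluxCutoff
import HarnessLib

/-!
# Estimates for the flux of `dv` through large coordinate spheres (Schoen–Yau 1979, (3.16))

Support file (all results proved, no definitions, no named facts) for the identity
`∫_N Δ_h v dV_h = −4πA` for a function `v = c + A/r + ω`, `ω = O₁(r⁻²)`, on a one-ended
asymptotically flat `3`-manifold (the content of the mass formula (3.16) in Schoen–Yau's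
Lemma 3.2, Comm. Math. Phys. 65 (1979): `A = −(1/4π) ∫_N (fv + h) √g dx = −(1/4π) ∫_N Δv`). In
the chart of the end the flux integrand `−⟨dχ_ρ, dv⟩_h √g` for the radial cut-offs `χ_ρ = χ(r/ρ)`
of `EndFluxCutoff.lean` is `∑ₖₗ W_{kl} ∂ₖV ∂ₗχ_ρ` with `W = (h_{ij})⁻¹ √(det h_{ij}) → δ`,
`V = v ∘ Φ`; this file supplies:

* `integral_deriv_radialProfile_div` — `∫₀^∞ χ'(r/ρ)/ρ dr = −1`;
* `integral_radialMainTerm` — **the model flux**: `∫_{ℝ³} χ'(‖z‖/ρ) ρ⁻¹ (−A/‖z‖²) dz = 4πA`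
  (polar coordinates, Mathlib's `integral_fun_norm_addHaar`, `|𝕊²| = 4π`);
* `fderiv_const_add_div_norm_apply`, `abs_modelGradient_le`,
  `sum_modelGradient_mul_fderiv_radialProfile` — the gradient `−A zₖ/‖z‖³` of the model
  `c + A/‖z‖`, its size `≤ |A|/‖z‖²`, and its pairing with `dχ_ρ`, which is the model integrand;
* `abs_fluxSum_sub_modelSum_le` — **the pointwise algebraic estimate**
  `|∑ₖₗ W_{kl} ∂ₖV ∂ₗχ − ∑ₖ gₖ ∂ₖχ| ≤ (9 η C_V C₁/r² + 3 C_ω C₁/r³)/ρ` when `|W − δ| ≤ η`,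
  `|∂V| ≤ C_V/r²`, `|∂V − g| ≤ C_ω/r³`, `|∂χ| ≤ C₁/ρ`;
* `AFEnd.tendsto_gramInvSqrtDet_cobounded`, `AFEnd.exists_radius_abs_gramInvSqrtDet_sub_one_le` —
  **`(h_{ij})⁻¹ √(det h_{ij}) → δ` at infinity** under `h − δ = O(r^{−α})`, `α > 0` (continuity
  of the inverse and of the determinant at `δ`), with an extracted radius for every `ε > 0`.

## References

* R. Schoen, S.-T. Yau, *On the proof of the positive mass conjecture in general relativity*,
  Comm. Math. Phys. 65 (1979) 45–76, proof of Lemma 3.2, (3.16).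
* R. Bartnik, *The mass of an asymptotically flat manifold*, CPAM 39 (1986), §4.
-/

noncomputable section

open Set Function Filter Metric MeasureTheory Measure TopologicalSpace Bornology Asymptotics
open scoped Topology RealInnerProductSpace Matrix ENNReal ContDiff Manifold

namespace Literature.Geometry.Lorentzian

/-! ### The model flux `∫ χ'(r/ρ) ρ⁻¹ (−A/r²) dz = 4πA` -/

section Model

variable {χ : ℝ → ℝ} (hχ : ContDiff ℝ ∞ χ) (h1 : ∀ s, s ≤ 1 → χ s = 1) (h2 : ∀ s, 2 ≤ s → χ s = 0)

include hχ h1 h2 in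
/-- **`∫₀^∞ χ'(r/ρ)/ρ dr = −1`** for a radial profile `χ` (`= 1` on `(−∞,1]`, `= 0` on `[2,∞)`)
and `ρ > 0`: the integrand is the derivative of `r ↦ χ(r/ρ)`, which is `1` at `0` and `0` at
infinity (Mathlib's `integral_Ioi_of_hasDerivAt_of_tendsto'`). [folklore] -/
theorem integral_deriv_radialProfile_div {ρ : ℝ} (hρ : 0 < ρ) :
    ∫ r in Ioi (0 : ℝ), deriv χ (r / ρ) / ρ = -1 := by
  have hderiv : ∀ r ∈ Ici (0 : ℝ), HasDerivAt (fun r ↦ χ (r / ρ)) (deriv χ (r / ρ) / ρ) r := by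
    intro r _
    have hχd : HasDerivAt χ (deriv χ (r / ρ)) (id r / ρ) := (hχ.differentiable (by simp) _).hasDerivAt
    refine (hχd.comp r ((hasDerivAt_id r).div_const ρ)).congr_deriv ?_
    ring
  -- the integrand is continuous and vanishes off `[ρ, 2ρ]`, hence integrable
  have hcont : Continuous fun r ↦ deriv χ (r / ρ) / ρ :=
    ((hχ.continuous_deriv (by simp)).comp (continuous_id.div_const ρ)).div_const ρ
  have hsupp : support (fun r ↦ deriv χ (r / ρ) / ρ) ⊆ Icc ρ (2 * ρ) := by
    intro r hr
    rw [mem_support] at hr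
    by_contra hrI
    apply hr
    rcases not_and_or.1 hrI with h | h
    · rw [deriv_radialProfile_eq_zero_of_lt_one h1 ((div_lt_one hρ).2 (not_le.1 h)), zero_div]
    · rw [deriv_radialProfile_eq_zero_of_two_lt h2 ((lt_div_iff₀ hρ).2 (by linarith [not_le.1 h])),
        zero_div]
  have hint : Integrable fun r ↦ deriv χ (r / ρ) / ρ :=
    hcont.integrable_of_hasCompactSupport
      (HasCompactSupport.intro' isCompact_Icc isClosed_Icc fun r hr ↦
        notMem_support.1 fun h ↦ hr (hsupp h))
  have hlim : Tendsto (fun r ↦ χ (r / ρ)) atTop (𝓝 0) := by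
    refine tendsto_const_nhds.congr' ?_
    filter_upwards [eventually_ge_atTop (2 * ρ)] with r hr
    exact (h2 _ ((le_div_iff₀ hρ).2 (by linarith))).symm
  rw [integral_Ioi_of_hasDerivAt_of_tendsto' hderiv hint.integrableOn hlim, zero_div, h1 0 zero_le_one]
  norm_num

include hχ h1 h2 in
/-- **The model flux.** For a radial profile `χ`, `ρ > 0` and `A ∈ ℝ`:
`∫_{ℝ³} χ'(‖z‖/ρ) ρ⁻¹ (−A/‖z‖²) dz = 4πA`. In polar coordinates
(`integral_fun_norm_addHaar`: `∫ f(‖z‖) dz = 3 |B₁| ∫₀^∞ r² f(r) dr`, `3|B₁| = 4π`) the radial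
factor `r²` cancels `r⁻²` and `∫₀^∞ χ'(r/ρ)/ρ dr = −1`. This is the flux `−∮ ∂(A/r)/∂n = 4πA` of
the monopole through a large sphere, smeared over the annulus `ρ ≤ r ≤ 2ρ` (Schoen–Yau 1979,
(3.16)). [cite: SchoenYauPMT1979, proof of Lemma 3.2, (3.16)] -/
theorem integral_radialMainTerm {ρ : ℝ} (hρ : 0 < ρ) (A : ℝ) :
    ∫ z : E3, deriv χ (‖z‖ / ρ) / ρ * (-A / ‖z‖ ^ 2) = 4 * Real.pi * A := by
  have hpolar := MeasureTheory.integral_fun_norm_addHaar (volume : Measure E3)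
    (fun r : ℝ ↦ deriv χ (r / ρ) / ρ * (-A / r ^ 2))
  rw [hpolar, finrank_euclideanSpace_fin]
  have hball : (volume : Measure E3).real (ball 0 1) = Real.pi * 4 / 3 := by
    rw [measureReal_def, EuclideanSpace.volume_ball_fin_three]
    simp [ENNReal.toReal_ofReal (by positivity : (0 : ℝ) ≤ Real.pi * 4 / 3)]
  rw [hball]
  have hrad : ∫ r in Ioi (0 : ℝ), r ^ (3 - 1) • (deriv χ (r / ρ) / ρ * (-A / r ^ 2)) =
      -A * ∫ r in Ioi (0 : ℝ), deriv χ (r / ρ) / ρ := by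
    rw [← integral_const_mul]
    refine setIntegral_congr_fun measurableSet_Ioi fun r hr ↦ ?_
    have hr0 : r ≠ 0 := (ne_of_gt hr)
    simp only [smul_eq_mul]
    field_simp
  rw [hrad, integral_deriv_radialProfile_div hχ h1 h2 hρ]
  simp only [nsmul_eq_mul, smul_eq_mul]
  push_cast
  ring

end Model

/-! ### The model gradient `−A zₖ/‖z‖³` -/

section Gradient

/-- The gradient of the model `c + A/‖z‖` away from the origin:
`∂ₖ(c + A/‖·‖)(z) = −A zₖ/‖z‖³` (`D(‖·‖⁻¹)(z) = −‖z‖⁻³ ⟪z, ·⟫`). [folklore] -/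
theorem fderiv_const_add_div_norm_apply (c A : ℝ) {z : E3} (hz : z ≠ 0) (k : Fin 3) :
    fderiv ℝ (fun y : E3 ↦ c + A / ‖y‖) z (EuclideanSpace.single k 1) = -A * z k / ‖z‖ ^ 3 := by
  have h : HasFDerivAt (fun y : E3 ↦ c + A / ‖y‖)
      (A • ((-(‖z‖ ^ 3)⁻¹) • (innerSL ℝ z : E3 →L[ℝ] ℝ))) z := by
    have := ((hasFDerivAt_inv_norm hz).const_mul A).const_add c
    simpa [div_eq_mul_inv] using this
  rw [h.fderiv]
  simp only [FunLike.coe_smul, Pi.smul_apply, innerSL_apply_apply, smul_eq_mul,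
    EuclideanSpace.inner_single_right, one_mul, conj_trivial]
  ring

/-- A coordinate is bounded by the norm: `|zₖ| ≤ ‖z‖` (a private copy of a lemma available in
unrelated parts of the tree). [folklore] -/
private theorem abs_apply_le_norm (z : E3) (k : Fin 3) : |z k| ≤ ‖z‖ := by
  have h := EuclideanSpace.real_norm_sq_eq z
  have hk : (z k) ^ 2 ≤ ∑ i, (z i) ^ 2 :=
    Finset.single_le_sum (f := fun i ↦ (z i) ^ 2) (fun i _ ↦ sq_nonneg _) (Finset.mem_univ k)
  rw [← h] at hk
  exact abs_le_of_sq_le_sq' hk (norm_nonneg z) |> fun h' ↦ abs_le.2 h'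

/-- The model gradient is `O(‖z‖⁻²)`: `|−A zₖ/‖z‖³| ≤ |A|/‖z‖²` (`z ≠ 0`). [folklore] -/
theorem abs_modelGradient_le (A : ℝ) {z : E3} (hz : z ≠ 0) (k : Fin 3) :
    |-A * z k / ‖z‖ ^ 3| ≤ |A| / ‖z‖ ^ 2 := by
  have hzn : 0 < ‖z‖ := norm_pos_iff.2 hz
  rw [abs_div, abs_mul, abs_neg, abs_of_pos (pow_pos hzn 3), div_le_div_iff₀ (pow_pos hzn 3)
    (pow_pos hzn 2)]
  have hk := abs_apply_le_norm z k
  nlinarith [abs_nonneg A, abs_nonneg (z k), pow_pos hzn 2, mul_nonneg (abs_nonneg A) (pow_pos hzn 2).le]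

/-- **The model gradient paired with the cut-off gradient is the model integrand**:
`∑ₖ (−A zₖ/‖z‖³) ∂ₖ(χ(‖·‖/ρ))(z) = χ'(‖z‖/ρ) ρ⁻¹ (−A/‖z‖²)` for `z ≠ 0`
(`∂ₖχ_ρ = χ'(r/ρ) ρ⁻¹ zₖ/r` and `∑ zₖ² = r²`). [folklore] -/
theorem sum_modelGradient_mul_fderiv_radialProfile {χ : ℝ → ℝ} (hχ : ContDiff ℝ ∞ χ) (ρ A : ℝ)
    {z : E3} (hz : z ≠ 0) :
    ∑ k, (-A * z k / ‖z‖ ^ 3) *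
        fderiv ℝ (fun y : E3 ↦ χ (‖y‖ / ρ)) z (EuclideanSpace.single k 1) =
      deriv χ (‖z‖ / ρ) / ρ * (-A / ‖z‖ ^ 2) := by
  have hzn : 0 < ‖z‖ := norm_pos_iff.2 hz
  simp_rw [fderiv_radialProfile_norm_div hχ hz, EuclideanSpace.inner_single_right, one_mul,
    conj_trivial]
  have hsq : ∑ k : Fin 3, z k * z k = ‖z‖ ^ 2 := by
    rw [EuclideanSpace.real_norm_sq_eq]
    exact Finset.sum_congr rfl fun k _ ↦ by ring
  have hterm : ∀ k : Fin 3, -A * z k / ‖z‖ ^ 3 * (deriv χ (‖z‖ / ρ) / ρ * (z k / ‖z‖)) =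
      (-A * (deriv χ (‖z‖ / ρ) / ρ) / ‖z‖ ^ 4) * (z k * z k) := fun k ↦ by
    field_simp
  simp_rw [hterm]
  rw [← Finset.mul_sum, hsq]
  field_simp

end Gradient

/-! ### The pointwise algebraic estimate -/

section Algebra

/-- **The flux integrand minus the model integrand, pointwise.** For a `3 × 3` coefficient
matrix `W` with `|W_{kl} − δ_{kl}| ≤ η`, vectors `dV` (the gradient of `V`), `g` (the model
gradient) and `dχ` (the cut-off gradient) with `|dVₖ| ≤ C_V/r²`, `|dVₖ − gₖ| ≤ C_ω/r³`,
`|dχₗ| ≤ C₁/ρ` (`η, C_V, C_ω ≥ 0`, `r > 0`):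
`|∑ₗ ∑ₖ W_{kl} dVₖ dχₗ − ∑ₖ gₖ dχₖ| ≤ (9 η C_V C₁/r² + 3 C_ω C₁/r³)/ρ`
(split `W = δ + (W − δ)` and `dV = g + (dV − g)`). [folklore] -/
theorem abs_fluxSum_sub_modelSum_le {W : Matrix (Fin 3) (Fin 3) ℝ} {dV g dχ : Fin 3 → ℝ}
    {η CV Cω C₁ r ρ : ℝ} (hη : 0 ≤ η) (hCV : 0 ≤ CV) (hCω : 0 ≤ Cω) (hr : 0 < r)
    (hW : ∀ k l, |W k l - (1 : Matrix (Fin 3) (Fin 3) ℝ) k l| ≤ η)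
    (hdV : ∀ k, |dV k| ≤ CV / r ^ 2) (hg : ∀ k, |dV k - g k| ≤ Cω / r ^ 3)
    (hdχ : ∀ l, |dχ l| ≤ C₁ / ρ) :
    |∑ l, ∑ k, W k l * dV k * dχ l - ∑ k, g k * dχ k| ≤
      (9 * η * CV * C₁ / r ^ 2 + 3 * Cω * C₁ / r ^ 3) / ρ := by
  -- the decomposition
  have hδ : ∑ l, ∑ k, (1 : Matrix (Fin 3) (Fin 3) ℝ) k l * dV k * dχ l = ∑ k, dV k * dχ k := by
    rw [Finset.sum_comm]
    refine Finset.sum_congr rfl fun k _ ↦ ?_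
    simp only [Matrix.one_apply, ite_mul, one_mul, zero_mul, Finset.sum_ite_eq, Finset.mem_univ,
      if_true]
  have hdec : ∑ l, ∑ k, W k l * dV k * dχ l - ∑ k, g k * dχ k =
      (∑ l, ∑ k, (W k l - (1 : Matrix (Fin 3) (Fin 3) ℝ) k l) * dV k * dχ l) +
        ∑ k, (dV k - g k) * dχ k := by
    have h1 : ∑ l, ∑ k, (W k l - (1 : Matrix (Fin 3) (Fin 3) ℝ) k l) * dV k * dχ l =
        ∑ l, ∑ k, W k l * dV k * dχ l -
          ∑ l, ∑ k, (1 : Matrix (Fin 3) (Fin 3) ℝ) k l * dV k * dχ l := by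
      rw [← Finset.sum_sub_distrib]
      refine Finset.sum_congr rfl fun l _ ↦ ?_
      rw [← Finset.sum_sub_distrib]
      refine Finset.sum_congr rfl fun k _ ↦ ?_
      ring
    have h2 : ∑ k, (dV k - g k) * dχ k = ∑ k, dV k * dχ k - ∑ k, g k * dχ k := by
      rw [← Finset.sum_sub_distrib]
      refine Finset.sum_congr rfl fun k _ ↦ ?_
      ring
    rw [h1, h2, hδ]
    ring
  rw [hdec]
  -- bounds for the two pieces
  have hT1 : |∑ l, ∑ k, (W k l - (1 : Matrix (Fin 3) (Fin 3) ℝ) k l) * dV k * dχ l| ≤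
      9 * η * CV * C₁ / r ^ 2 / ρ := by
    have hterm : ∀ k l, |(W k l - (1 : Matrix (Fin 3) (Fin 3) ℝ) k l) * dV k * dχ l| ≤
        η * (CV / r ^ 2) * (C₁ / ρ) := fun k l ↦ by
      rw [abs_mul, abs_mul]
      exact mul_le_mul (mul_le_mul (hW k l) (hdV k) (abs_nonneg _) hη) (hdχ l) (abs_nonneg _)
        (mul_nonneg hη (by positivity))
    calc |∑ l, ∑ k, (W k l - (1 : Matrix (Fin 3) (Fin 3) ℝ) k l) * dV k * dχ l|
        ≤ ∑ l, |∑ k, (W k l - (1 : Matrix (Fin 3) (Fin 3) ℝ) k l) * dV k * dχ l| :=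
          Finset.abs_sum_le_sum_abs _ _
      _ ≤ ∑ l, ∑ k, |(W k l - (1 : Matrix (Fin 3) (Fin 3) ℝ) k l) * dV k * dχ l| :=
          Finset.sum_le_sum fun l _ ↦ Finset.abs_sum_le_sum_abs _ _
      _ ≤ ∑ _l : Fin 3, ∑ _k : Fin 3, η * (CV / r ^ 2) * (C₁ / ρ) :=
          Finset.sum_le_sum fun l _ ↦ Finset.sum_le_sum fun k _ ↦ hterm k l
      _ = 9 * η * CV * C₁ / r ^ 2 / ρ := by
          simp only [Finset.sum_const, Finset.card_univ, Fintype.card_fin, nsmul_eq_mul]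
          push_cast
          ring
  have hT2 : |∑ k, (dV k - g k) * dχ k| ≤ 3 * Cω * C₁ / r ^ 3 / ρ := by
    have hterm : ∀ k, |(dV k - g k) * dχ k| ≤ (Cω / r ^ 3) * (C₁ / ρ) := fun k ↦ by
      rw [abs_mul]
      exact mul_le_mul (hg k) (hdχ k) (abs_nonneg _) (by positivity)
    calc |∑ k, (dV k - g k) * dχ k| ≤ ∑ k, |(dV k - g k) * dχ k| := Finset.abs_sum_le_sum_abs _ _
      _ ≤ ∑ _k : Fin 3, (Cω / r ^ 3) * (C₁ / ρ) := Finset.sum_le_sum fun k _ ↦ hterm k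
      _ = 3 * Cω * C₁ / r ^ 3 / ρ := by
          simp only [Finset.sum_const, Finset.card_univ, Fintype.card_fin, nsmul_eq_mul]
          push_cast
          ring
  calc |(∑ l, ∑ k, (W k l - (1 : Matrix (Fin 3) (Fin 3) ℝ) k l) * dV k * dχ l) +
        ∑ k, (dV k - g k) * dχ k|
      ≤ |∑ l, ∑ k, (W k l - (1 : Matrix (Fin 3) (Fin 3) ℝ) k l) * dV k * dχ l| +
          |∑ k, (dV k - g k) * dχ k| := abs_add_le _ _
    _ ≤ 9 * η * CV * C₁ / r ^ 2 / ρ + 3 * Cω * C₁ / r ^ 3 / ρ := add_le_add hT1 hT2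
    _ = (9 * η * CV * C₁ / r ^ 2 + 3 * Cω * C₁ / r ^ 3) / ρ := by ring

end Algebra

/-! ### The coefficient matrix `(h_{ij})⁻¹ √(det h_{ij})` tends to `δ` at infinity -/

namespace AFEnd

variable {X : Type} [TopologicalSpace X] [ChartedSpace E3 X] [IsManifold (𝓡 3) ∞ X]
  (e : AFEnd X) (D : InitialDataSet (𝓡 3) X)

/-- **The Gram matrix of the end tends to `δ`**: under `h − δ = O₂(r^{−α})`, `α > 0`,
`h_{ij}(z) → δ_{ij}` entrywise, i.e. as matrices, as `‖z‖ → ∞`. [folklore] -/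
theorem tendsto_gram_hCoeff_cobounded {α : ℝ} (hα : 0 < α) (hAF : e.IsMetricAsymptoticallyFlat D α) :
    Tendsto (fun z : E3 ↦ (Matrix.of fun i j ↦ hCoeff e D z (EuclideanSpace.single i 1)
      (EuclideanSpace.single j 1) : Matrix (Fin 3) (Fin 3) ℝ)) (cobounded E3) (𝓝 1) := by
  -- `‖h(z) − δ‖ → 0`
  have h0 : Tendsto (fun z : E3 ↦ ‖hCoeff e D z - (innerSL ℝ : E3 →L[ℝ] E3 →L[ℝ] ℝ)‖)
      (cobounded E3) (𝓝 0) := by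
    have hO := hAF 0 (Nat.zero_le _)
    have hr : Tendsto (fun z : E3 ↦ ‖z‖ ^ (-α - (0 : ℕ) : ℝ)) (cobounded E3) (𝓝 0) := by
      simp only [Nat.cast_zero, sub_zero]
      exact (tendsto_rpow_neg_atTop hα).comp tendsto_norm_cobounded_atTop
    have h := hO.trans_tendsto hr
    refine h.congr fun z ↦ ?_
    rw [norm_iteratedFDeriv_zero]
  -- entrywise convergence
  refine tendsto_pi_nhds.2 fun i ↦ tendsto_pi_nhds.2 fun j ↦ ?_
  have hb := abs_gram_sub_one_le (EuclideanSpace.basisFun (Fin 3) ℝ) (G := hCoeff e D)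
  have hent : Tendsto (fun z : E3 ↦ (Matrix.of fun i j ↦ hCoeff e D z (EuclideanSpace.single i 1)
      (EuclideanSpace.single j 1)) i j - (1 : Matrix (Fin 3) (Fin 3) ℝ) i j) (cobounded E3) (𝓝 0) := by
    refine squeeze_zero_norm (fun z ↦ ?_) h0
    rw [Real.norm_eq_abs]
    have := hb z i j
    simpa only [EuclideanSpace.basisFun_apply] using this
  have := hent.add_const ((1 : Matrix (Fin 3) (Fin 3) ℝ) i j)
  simpa using this

/-- **`(h_{ij})⁻¹ √(det h_{ij}) → δ` at infinity** (entrywise, as matrices): the inverse and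
the determinant are continuous at the identity matrix (Mathlib's `continuousAt_matrix_inv`,
`Continuous.matrix_det`). [folklore] -/
theorem tendsto_gramInvSqrtDet_cobounded {α : ℝ} (hα : 0 < α)
    (hAF : e.IsMetricAsymptoticallyFlat D α) :
    Tendsto (fun z : E3 ↦ Real.sqrt (Matrix.of fun i j ↦ hCoeff e D z (EuclideanSpace.single i 1)
        (EuclideanSpace.single j 1) : Matrix (Fin 3) (Fin 3) ℝ).det •
      (Matrix.of fun i j ↦ hCoeff e D z (EuclideanSpace.single i 1)
        (EuclideanSpace.single j 1) : Matrix (Fin 3) (Fin 3) ℝ)⁻¹) (cobounded E3) (𝓝 1) := by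
  have hH := e.tendsto_gram_hCoeff_cobounded D hα hAF
  -- the inverse
  have hinv : ContinuousAt (Inv.inv : Matrix (Fin 3) (Fin 3) ℝ → Matrix (Fin 3) (Fin 3) ℝ) 1 := by
    refine continuousAt_matrix_inv _ ?_
    rw [Matrix.det_one]
    have : (Ring.inverse : ℝ → ℝ) = Inv.inv := Ring.inverse_eq_inv'
    rw [this]
    exact continuousAt_inv₀ one_ne_zero
  have hI : Tendsto (fun z : E3 ↦ (Matrix.of fun i j ↦ hCoeff e D z (EuclideanSpace.single i 1)
      (EuclideanSpace.single j 1) : Matrix (Fin 3) (Fin 3) ℝ)⁻¹) (cobounded E3) (𝓝 1) := by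
    have := hinv.tendsto.comp hH
    rw [inv_one] at this
    exact this
  -- the determinant
  have hdet : Tendsto (fun z : E3 ↦ Real.sqrt (Matrix.of fun i j ↦ hCoeff e D z
      (EuclideanSpace.single i 1) (EuclideanSpace.single j 1) : Matrix (Fin 3) (Fin 3) ℝ).det)
      (cobounded E3) (𝓝 1) := by
    have h1 : Tendsto (fun z : E3 ↦ (Matrix.of fun i j ↦ hCoeff e D z
        (EuclideanSpace.single i 1) (EuclideanSpace.single j 1) : Matrix (Fin 3) (Fin 3) ℝ).det)
        (cobounded E3) (𝓝 (1 : Matrix (Fin 3) (Fin 3) ℝ).det) :=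
      (continuous_id.matrix_det.tendsto _).comp hH
    rw [Matrix.det_one] at h1
    have h2 := (Real.continuous_sqrt.tendsto 1).comp h1
    rwa [Real.sqrt_one] at h2
  have := hdet.smul hI
  rwa [one_smul] at this

/-- **A radius beyond which `(h_{ij})⁻¹ √(det h_{ij})` is `ε`-close to `δ`** entrywise, for
every `ε > 0`. [folklore] -/
theorem exists_radius_abs_gramInvSqrtDet_sub_one_le {α : ℝ} (hα : 0 < α)
    (hAF : e.IsMetricAsymptoticallyFlat D α) {ε : ℝ} (hε : 0 < ε) :
    ∃ ρ₀ : ℝ, ∀ z : E3, ρ₀ ≤ ‖z‖ → ∀ k l,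
      |(Matrix.of fun i j ↦ hCoeff e D z (EuclideanSpace.single i 1)
          (EuclideanSpace.single j 1) : Matrix (Fin 3) (Fin 3) ℝ)⁻¹ k l *
        Real.sqrt (Matrix.of fun i j ↦ hCoeff e D z (EuclideanSpace.single i 1)
          (EuclideanSpace.single j 1) : Matrix (Fin 3) (Fin 3) ℝ).det -
        (1 : Matrix (Fin 3) (Fin 3) ℝ) k l| ≤ ε := by
  have h := e.tendsto_gramInvSqrtDet_cobounded D hα hAF
  have hkl : ∀ k l, ∀ᶠ z in cobounded E3,
      |(Matrix.of fun i j ↦ hCoeff e D z (EuclideanSpace.single i 1)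
          (EuclideanSpace.single j 1) : Matrix (Fin 3) (Fin 3) ℝ)⁻¹ k l *
        Real.sqrt (Matrix.of fun i j ↦ hCoeff e D z (EuclideanSpace.single i 1)
          (EuclideanSpace.single j 1) : Matrix (Fin 3) (Fin 3) ℝ).det -
        (1 : Matrix (Fin 3) (Fin 3) ℝ) k l| ≤ ε := by
    intro k l
    have hk : Tendsto (fun z : E3 ↦ (Real.sqrt (Matrix.of fun i j ↦ hCoeff e D z
        (EuclideanSpace.single i 1) (EuclideanSpace.single j 1) : Matrix (Fin 3) (Fin 3) ℝ).det •
        (Matrix.of fun i j ↦ hCoeff e D z (EuclideanSpace.single i 1)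
          (EuclideanSpace.single j 1) : Matrix (Fin 3) (Fin 3) ℝ)⁻¹) k) (cobounded E3)
        (𝓝 ((1 : Matrix (Fin 3) (Fin 3) ℝ) k)) := tendsto_pi_nhds.1 h k
    have hkl : Tendsto (fun z : E3 ↦ (Real.sqrt (Matrix.of fun i j ↦ hCoeff e D z
        (EuclideanSpace.single i 1) (EuclideanSpace.single j 1) : Matrix (Fin 3) (Fin 3) ℝ).det •
        (Matrix.of fun i j ↦ hCoeff e D z (EuclideanSpace.single i 1)
          (EuclideanSpace.single j 1) : Matrix (Fin 3) (Fin 3) ℝ)⁻¹) k l) (cobounded E3)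
        (𝓝 ((1 : Matrix (Fin 3) (Fin 3) ℝ) k l)) := tendsto_pi_nhds.1 hk l
    have hev := (Metric.tendsto_nhds.1 hkl) ε hε
    filter_upwards [hev] with z hz
    rw [Real.dist_eq] at hz
    refine le_of_lt (by simpa [Matrix.smul_apply, smul_eq_mul, mul_comm] using hz)
  have hall : ∀ᶠ z in cobounded E3, ∀ k l,
      |(Matrix.of fun i j ↦ hCoeff e D z (EuclideanSpace.single i 1)
          (EuclideanSpace.single j 1) : Matrix (Fin 3) (Fin 3) ℝ)⁻¹ k l *
        Real.sqrt (Matrix.of fun i j ↦ hCoeff e D z (EuclideanSpace.single i 1)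
          (EuclideanSpace.single j 1) : Matrix (Fin 3) (Fin 3) ℝ).det -
        (1 : Matrix (Fin 3) (Fin 3) ℝ) k l| ≤ ε :=
    eventually_all.2 fun k ↦ eventually_all.2 fun l ↦ hkl k l
  obtain ⟨ρ₀, -, hρ₀⟩ := (hasBasis_cobounded_norm (E := E3)).eventually_iff.1 hall
  exact ⟨ρ₀, fun z hz ↦ hρ₀ (show z ∈ {x | ρ₀ ≤ ‖x‖} from hz)⟩

end AFEnd

end Literature.Geometry.Lorentzian

end
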